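import Mathlib
import HarnessLib
import Summits.HodgeConjecture.Statement
import Summits.HodgeConjecture.HodgeConjecture.Theses.SignSymmetricPowers
import Literature.AlgebraicGeometry.Motives.Sweep1
import Literature.AlgebraicGeometry.Motives.HodgeTensorFactsHolds
import Literature.AlgebraicGeometry.Motives.SmoothHypersurfaceScheme
import Literature.AlgebraicGeometry.Motives.HypersurfaceFormsNonsingular
import Literature.AlgebraicGeometry.Motives.FermatHypersurface
import Literature.AlgebraicGeometry.HodgeTheory.BettiUniverseAxioms
import Literature.AlgebraicGeometry.HodgeTheory.UniversalHypersurfaceDiscriminantExists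
import Literature.AlgebraicGeometry.HodgeTheory.ComplexConjugationHolds
import Literature.AlgebraicGeometry.HodgeTheory.HodgeRiemannPolarizabilityProofs
import Literature.AlgebraicGeometry.HodgeTheory.DiagonalSymmetry
import Literature.AlgebraicGeometry.HodgeTheory.SymmetricHypersurfaceInvolution
import Literature.AlgebraicGeometry.HodgeTheory.HypersurfaceEigenHodgeNumbersJacobian
import Literature.AlgebraicGeometry.HodgeTheory.AlgebraicMonodromyMumfordTate
import Literature.AlgebraicGeometry.HodgeTheory.SymplecticTransvectionGroupDensity
import Literature.AlgebraicGeometry.HodgeTheory.SignSymmetricTransvectionMonodromy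
import Literature.AlgebraicGeometry.HodgeTheory.SignSymmetricCentraliserCommutatorsHodgeGroup
import Literature.AlgebraicGeometry.FundamentalGroup.HypersurfaceComplementMeridians
import Literature.AlgebraicGeometry.HodgeTheory.PicardLefschetzNodalForms
import Literature.AlgebraicGeometry.HodgeTheory.GlobalInvariantCycles
import Literature.AlgebraicGeometry.HodgeTheory.UniversalHypersurfaceDiscriminant
import Literature.AlgebraicGeometry.Motives.MonomialSupportedHypersurfaceSymmetry
import Literature.AlgebraicGeometry.HodgeTheory.BettiUniverseOddCupAlternating
import Literature.AlgebraicGeometry.HodgeTheory.MonomialSupportedHypersurfaceFamilyPoints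
import Literature.AlgebraicGeometry.HodgeTheory.PicardLefschetzSymmetricA3
import Summits.HodgeConjecture.HodgeConjecture.Theorems.SignSymmetricPowersFibreCoreC
import Summits.HodgeConjecture.HodgeConjecture.Theorems.SignSymmetricPowersNoInvariants
import Summits.HodgeConjecture.HodgeConjecture.Theorems.SignSymmetricPowersPencilTransvections
import Summits.HodgeConjecture.HodgeConjecture.Theorems.SignSymmetricPowersMeridianGeneration
import Summits.HodgeConjecture.HodgeConjecture.Theorems.SignSymmetricPowersConfluenceLinkG

/-!
# Route `SignSymmetricPowers`, crux K1-B `VeryGeneralSignCommutatorsInHg` (stmt-HodgeConjecture-19716) — the GEO statement from the landed pieces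

Theorem-only port of the kernel-checked seam `signPencilOrbitData_of_pieces` / `signPencilOrbitDataF_of_pieces` of the
registered skeleton `line-andre-zariski` v12f (sha16 `276eda50fce4ca90`, HOME/p3/k1line-v12f-g25/) with the five THEOREM pieces
substituted by their landed names: `stub_signFibreCoreC` (p557067), `stub_signNoInvariants` (p562551),
`stub_signPencilTransvections` (p559818), `stub_signMeridianGeneration` (p574892), `stub_signConfluenceLinkG` (p574760).
The result `signPencilOrbitDataF_of_facts` is the REGISTERED text of the derived GEO binder `stub_signPencilOrbitData`
(`SignPencilOrbitDataF`, fact-relative over F-ZvK / F-PL / F-GIC / F-DISC-0 / F-DISC-1 / the nodal forms) modulo the two named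
facts the LINK piece consumes: `picardLefschetz_symmetricA3` (F-B2PL) and `affineHypersurfaceComplement_meridian_isConj` (F-MC).
No new mathematics: statements and proof are the skeleton's, verbatim up to the substitution (the family is
`familyM ℂ 3 d M_ι`, `pt := classifyingPoint t₀`, `B := c⁻¹ • (tr ∘ cup)`, `τ := σ_M^*`; generators and links from GEN's three
pencil circles read through PEN and LINK; `H³ ≠ 0` from the first link).
-/

set_option linter.dupNamespace false
set_option linter.unusedVariables false
set_option maxHeartbeats 800000

namespace Summit.HodgeConjecture.HodgeConjecture.Theorems.SignSymmetricPowersPencilOrbitData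

open Literature.AlgebraicGeometry.Motives Literature.AlgebraicGeometry.HodgeTheory
open Literature.AlgebraicGeometry.HodgeTheory.BettiUniverse
open Literature.AlgebraicTopology.SingularHomology
open CategoryTheory
open Summit.HodgeConjecture.HodgeConjecture.Theorems.SignSymmetricPowersConfluenceLinkG (isSupportedOn_of_coeff_odd_eq_zero)

/-- v12 helper: `M_ι`-support of a degree-`d` form is GEO's evenness clause. -/
theorem coeff_odd_eq_zero_of_isSupportedOn {d : ℕ} {f : MvPolynomial (Fin 5) ℂ} (hf : f.IsHomogeneous d)
    (hM : Literature.AlgebraicGeometry.Motives.UniversalHypersurface.IsSupportedOn 3 d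
      {m : Literature.AlgebraicGeometry.Motives.UniversalHypersurface.DegIndex 3 d | Even (m.1 0 + m.1 1)} f) :
    ∀ e : Fin 5 →₀ ℕ, ¬ Even (e 0 + e 1) → f.coeff e = 0 := by
  intro e he
  by_cases hdeg : e.degree = d
  · exact hM ⟨e, hdeg⟩ he
  · exact hf.coeff_eq_zero hdeg

/-! ### v12d seam helpers — rescaling a bilinear form by a unit (pure linear algebra over a field) -/

section SmulForm
variable {K V : Type*} [Field K] [AddCommGroup V] [Module K V]

/-- v12d: `a • B` is alternating if `B` is. -/
theorem isAlt_smul_form {B : LinearMap.BilinForm K V} (hB : B.IsAlt) (a : K) : (a • B).IsAlt := fun x => by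
  simp only [LinearMap.smul_apply, hB x, smul_zero]

/-- v12d: `a • B` is non-degenerate if `B` is and `a ≠ 0`. -/
theorem nondegenerate_smul_form {B : LinearMap.BilinForm K V} (hB : B.Nondegenerate) {a : K} (ha : a ≠ 0) :
    (a • B).Nondegenerate := by
  refine ⟨fun x hx => hB.1 x fun y => ?_, fun y hy => hB.2 y fun x => ?_⟩
  · simpa only [LinearMap.smul_apply, smul_eq_mul, mul_eq_zero, ha, false_or] using hx y
  · simpa only [LinearMap.smul_apply, smul_eq_mul, mul_eq_zero, ha, false_or] using hy x

/-- v12d: invariance of `B` under a map `f` (in both arguments) passes to `a • B`. -/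
theorem smul_form_invariant {B : LinearMap.BilinForm K V} {f : V → V} (h : ∀ x y, B (f x) (f y) = B x y) (a : K) :
    ∀ x y, (a • B) (f x) (f y) = (a • B) x y := fun x y => by
  simp only [LinearMap.smul_apply, h x y]

/-- v12d: invariance of `B` under every element of a subgroup passes to `a • B`. -/
theorem smul_form_invariant_subgroup {B : LinearMap.BilinForm K V} {Γ : Subgroup (V ≃ₗ[K] V)}
    (h : ∀ g ∈ Γ, ∀ x y, B (g x) (g y) = B x y) (a : K) :
    ∀ g ∈ Γ, ∀ x y, (a • B) (g x) (g y) = (a • B) x y := fun g hg x y => by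
  simp only [LinearMap.smul_apply, h g hg x y]

/-- v12d: `B x y = c * B' x y` with `c ≠ 0` ⇒ `(c⁻¹ • B) x y = B' x y`. -/
theorem inv_smul_form_eq {B : LinearMap.BilinForm K V} {B' : V → V → K} {c : K} (hc : c ≠ 0)
    (h : ∀ x y, B x y = c * B' x y) : ∀ x y, (c⁻¹ • B) x y = B' x y := fun x y => by
  rw [LinearMap.smul_apply, LinearMap.smul_apply, h x y, smul_eq_mul, inv_mul_cancel_left₀ hc]

/-- v12d: a vanishing value of `B` is a vanishing value of `a • B`. -/
theorem smul_form_apply_eq_zero {B : LinearMap.BilinForm K V} {x y : V} (h : B x y = 0) (a : K) : (a • B) x y = 0 := by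
  simp only [LinearMap.smul_apply, h, smul_zero]

/-- v12d: a non-vanishing value of `B` is a non-vanishing value of `c⁻¹ • B` (`c ≠ 0`). -/
theorem inv_smul_form_apply_ne_zero {B : LinearMap.BilinForm K V} {x y : V} (h : B x y ≠ 0) {c : K} (hc : c ≠ 0) :
    (c⁻¹ • B) x y ≠ 0 := by
  simpa only [LinearMap.smul_apply, smul_eq_mul] using mul_ne_zero (inv_ne_zero hc) h

/-- v12d: the transvection of the rescaled form `c⁻¹ • B` with parameter `t * c` is the transvection of `B` with parameter `t`. -/
theorem oneParamTransvectionEquiv_inv_smul (B : LinearMap.BilinForm K V) {δ : V} (hδ : B δ δ = 0) {c : K} (hc : c ≠ 0) (t : K) :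
    Literature.AlgebraicGeometry.HodgeTheory.oneParamTransvectionEquiv (c⁻¹ • B) (smul_form_apply_eq_zero hδ c⁻¹) (t * c) =
      Literature.AlgebraicGeometry.HodgeTheory.oneParamTransvectionEquiv B hδ t := by
  refine LinearEquiv.ext fun x => ?_
  change Literature.AlgebraicGeometry.HodgeTheory.oneParamTransvection (c⁻¹ • B) δ (t * c) x =
    Literature.AlgebraicGeometry.HodgeTheory.oneParamTransvection B δ t x
  rw [Literature.AlgebraicGeometry.HodgeTheory.oneParamTransvection_apply,
    Literature.AlgebraicGeometry.HodgeTheory.oneParamTransvection_apply, LinearMap.smul_apply, LinearMap.smul_apply, smul_eq_mul,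
    show t * c * (c⁻¹ * B x δ) = t * B x δ by rw [← mul_assoc, mul_assoc t, mul_inv_cancel₀ hc, mul_one]]

end SmulForm

open Literature.AlgebraicGeometry.Motives Literature.AlgebraicGeometry.Motives.UniversalHypersurface Literature.AlgebraicGeometry.HodgeTheory Literature.AlgebraicGeometry.HodgeTheory.UniversalHypersurface Literature.AlgebraicGeometry.HodgeTheory.BettiUniverse CategoryTheory.Limits in
/-- **The GEO statement `SignPencilOrbitData` of skeleton v12f from the landed pieces** (port of the seam
`signPencilOrbitData_of_pieces`): FIB-core, NOINV, PEN, GEN, LINK-G BY NAME, the nodal forms and the facts F-ZvK, F-PL, F-GIC,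
F-DISC-0 (inlined, degree-free), F-DISC-1 as hypotheses, plus F-B2PL and F-MC consumed by LINK-G. -/
theorem signPencilOrbitData_of_facts (hB2 : Literature.AlgebraicGeometry.HodgeTheory.picardLefschetz_symmetricA3)
    (hMC : Literature.AlgebraicGeometry.FundamentalGroup.affineHypersurfaceComplement_meridian_isConj)
    (hZvK : Literature.AlgebraicGeometry.FundamentalGroup.affineHypersurfaceComplement_meridians_normalClosure_eq_top)
    (hPL : picardLefschetz_nodalForms_uniform) (hGIC : deligne_globalInvariantCycles)
    (hD0 : (∀ (n d : ℕ), 2 ≤ d → ∃ Disc : MvPolynomial (Literature.AlgebraicGeometry.Motives.UniversalHypersurface.DegIndex n d) ℂ, Irreducible Disc ∧ Disc.IsHomogeneous Disc.totalDegree ∧ 0 < Disc.totalDegree ∧ ∀ a : Literature.AlgebraicGeometry.Motives.UniversalHypersurface.DegIndex n d → ℂ, a ∈ Literature.AlgebraicGeometry.HodgeTheory.singularCoeffs n d ↔ MvPolynomial.eval a Disc = 0)) (hD1 : discriminant_localBranches_nodal) (hNodal : ∀ ⦃d : ℕ⦄, Even d → 4 ≤ d → (∃ f : MvPolynomial (Fin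 5) ℂ, f.IsHomogeneous d ∧ (∀ e : Fin 5 →₀ ℕ, ¬ Even (e 0 + e 1) → f.coeff e = 0) ∧ Literature.AlgebraicGeometry.HodgeTheory.IsNodalFormWithNodes f ![(![0, 0, 0, 0, 1] : Fin 5 → ℂ)]) ∧ (∃ f : MvPolynomial (Fin 5) ℂ, f.IsHomogeneous d ∧ (∀ e : Fin 5 →₀ ℕ, ¬ Even (e 0 + e 1) → f.coeff e = 0) ∧ Literature.AlgebraicGeometry.HodgeTheory.IsNodalFormWithNodes f ![(![1, 0, 0, 0, 0] : Fin 5 → ℂ)]) ∧ (∃ f : MvPolynomial (Fin 5) ℂ, f.IsHomogeneous d ∧ (∀ e : Fin 5 →₀ ℕ, ¬ Even (e 0 + e 1) → f.coeff e = 0) ∧ Literature.AlgebraicGeometry.HodgeTheory.IsNodalFormWithNodes f ![(![1, 0, 1, 0, 0] : Fin 5 → ℂ), ![-1, 0, 1, 0, 0]])) :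
    open Literature.AlgebraicGeometry.Motives Literature.AlgebraicGeometry.HodgeTheory Literature.AlgebraicGeometry.HodgeTheory.BettiUniverse CategoryTheory.Limits in ∀ ⦃d : ℕ⦄, Even d → 4 ≤ d → ∃ (𝒳 S : SchemeOver ℂ) (u : 𝒳 ⟶ S) (hu : IsSmoothProjectiveFamily u 3) (_ : IsQuasiProjectiveOver S) (_ : AlgebraicGeometry.Smooth S.hom) (_ : IrreducibleSpace S.left) (hU : IsCohomologicallyLocallyTrivialOn u (Set.univ : Set (ComplexPoints S))) (A : ∀ t : ComplexPoints S, HodgeModel 3 (fiberOver u t)) (hA : ∀ t, (A t).IsHodgeSymmetric) (hfin : ∀ t : ComplexPoints S, Module.Finite ℚ (bettiCohomology (fiberOver u t) 3)) (pt : MvPolynomial (Fin 5) ℂ → ComplexPoints S), (∀ W : Set (ComplexPoints S), IsZariskiClosedOnPoints S W → W ≠ Set.univ → ∃ G : MvPolynomial {e : Fin 5 →₀ ℕ // e.degree = d} ℂ, (∃ f : MvPolynomial (Fin 5) ℂ, f.IsHomogeneous d ∧ (∀ e : Fin 5 →₀ ℕ, ¬ Even (e 0 + e 1) → f.coeff e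 = 0) ∧ MvPolynomial.eval (fun e : {e : Fin 5 →₀ ℕ // e.degree = d} => f.coeff e.1) G ≠ 0) ∧ ∀ f : MvPolynomial (Fin 5) ℂ, f.IsHomogeneous d → (∀ e : Fin 5 →₀ ℕ, ¬ Even (e 0 + e 1) → f.coeff e = 0) → IsSmoothProjective 3 (SmoothHypersurface.hypersurface f) → MvPolynomial.eval (fun e : {e : Fin 5 →₀ ℕ // e.degree = d} => f.coeff e.1) G ≠ 0 → pt f ∉ W) ∧ (∀ f : MvPolynomial (Fin 5) ℂ, f.IsHomogeneous d → (∀ e : Fin 5 →₀ ℕ, ¬ Even (e 0 + e 1) → f.coeff e = 0) → SmoothHypersurface.IsNonsingularForm ℂ f → ∀ (hXF : IsSmoothProjective 3 (SmoothHypersurface.hypersurface f)) (ha : (fun i : Fin 5 => if (i : ℕ) < 2 then (-1 : ℂˣ) else 1) ∈ diagonalStabilizer f), ∃ (φ : bettiCohomology (fiberOver u (pt f)) 3 ≃ₗ[ℚ] bettiCohomology (SmoothHypersurface.hypersurface f) 3) (B : LinearMap.BilinForm ℚ (bettiCohomology (fiberOver u (pt f)) 3)) (hB : B.IsAlt) (_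 : B.Nondegenerate) (τ : bettiCohomology (fiberOver u (pt f)) 3 →ₗ[ℚ] bettiCohomology (fiberOver u (pt f)) 3) (_ : τ ^ 2 = 1) (rP rL δ₀ : bettiCohomology (fiberOver u (pt f)) 3) (c₁ c₂ c₃ : ℚ) (E : Set (bettiCohomology (fiberOver u (pt f)) 3 ≃ₗ[ℚ] bettiCohomology (fiberOver u (pt f)) 3)), let Γ := (haveI := hfin (pt f); ratMonodromyGroup u 3 hU ⟨pt f, Set.mem_univ _⟩); Nontrivial (bettiCohomology (fiberOver u (pt f)) 3) ∧ (∀ x y, B (τ x) (τ y) = B x y) ∧ (∀ x, φ (τ x) = pull (diagonalAut f ha) 3 (φ x)) ∧ (∀ x y, B x y = tr hXF (3 + 3) (cup (SmoothHypersurface.hypersurface f) 3 3 (φ x) (φ y))) ∧ (haveI : HodgeTensorFacts.{0, 0} := hodgeTensorFacts_holds; haveI := finite hXF 3; haveI := hfin (pt f); ∀ k : bettiCohomology (fiberOver u (pt f)) 3 ≃ₗ[ℚ] bettiCohomology (fiberOver u (pt f)) 3, k ∈ ((A (pt f)).hodgeStructure (hu.isSmoothProjective (pt f)) (hA (pt f))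 3).hodgeGroup → (φ.symm.trans k).trans φ ∈ (hodge exists_isReal_hodgeModel_holds hXF 3).hodgeGroup) ∧ (∀ g ∈ Γ, ∀ x, g (τ x) = τ (g x)) ∧ (∀ g ∈ Γ, ∀ x y, B (g x) (g y) = B x y) ∧ τ rP = rP ∧ τ rL = -rL ∧ B δ₀ (τ δ₀) = 0 ∧ c₁ ≠ 0 ∧ c₂ ≠ 0 ∧ c₃ ≠ 0 ∧ oneParamTransvectionEquiv B (hB rP) c₁ ∈ Γ ∧ oneParamTransvectionEquiv B (hB rL) c₂ ∈ Γ ∧ oneParamTransvectionEquiv B (hB δ₀) c₃ * oneParamTransvectionEquiv B (hB (τ δ₀)) c₃ ∈ Γ ∧ Γ = Subgroup.closure E ∧ (∀ e ∈ E, ∃ g ∈ Γ, e = g * oneParamTransvectionEquiv B (hB rP) c₁ * g⁻¹ ∨ e = g * oneParamTransvectionEquiv B (hB rL) c₂ * g⁻¹ ∨ e = g * (oneParamTransvectionEquiv B (hB δ₀) c₃ * oneParamTransvectionEquiv B (hB (τ δ₀)) c₃) * g⁻¹) ∧ (∀ x : bettiCohomology (fiberOver u (pt f)) 3, (∀ g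 ∈ Γ, g x = x) → x = 0) ∧ (∃ g ∈ Γ, B rP (g δ₀) ≠ 0) ∧ (∃ g ∈ Γ, B rL (g δ₀) ≠ 0)) := by
  classical
  intro d hd h4d
  obtain ⟨hirr, ⟨t₀⟩, hγ, A, hA, hFIBt⟩ := Summit.HodgeConjecture.HodgeConjecture.Theorems.SignSymmetricPowersFibreCoreB.stub_signFibreCoreC hd h4d
  have hu : IsSmoothProjectiveFamily (familyM ℂ 3 d {m : DegIndex 3 d | Even (m.1 0 + m.1 1)}) 3 := isSmoothProjectiveFamily_familyM ℂ 3 d {m : DegIndex 3 d | Even (m.1 0 + m.1 1)} (by decide) (le_trans (by decide) h4d)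
  refine ⟨totalM ℂ 3 d {m : DegIndex 3 d | Even (m.1 0 + m.1 1)}, baseM ℂ 3 d {m : DegIndex 3 d | Even (m.1 0 + m.1 1)}, (familyM ℂ 3 d {m : DegIndex 3 d | Even (m.1 0 + m.1 1)}), hu, isQuasiProjectiveOver_baseM 3 d {m : DegIndex 3 d | Even (m.1 0 + m.1 1)},
    smooth_baseM_hom ℂ 3 d {m : DegIndex 3 d | Even (m.1 0 + m.1 1)}, hirr, isCohomologicallyLocallyTrivialOn_familyM 3 d {m : DegIndex 3 d | Even (m.1 0 + m.1 1)} (by decide) (le_trans (by decide) h4d), A, hA,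
    fun s => finite (hu.isSmoothProjective s) 3, classifyingPoint ℂ 3 d {m : DegIndex 3 d | Even (m.1 0 + m.1 1)} t₀, ?_, ?_⟩
  · -- ALG avoidance: landed `alg_baseM_classifyingPoint`
    intro W hW hW'
    obtain ⟨G, ⟨f, hf, hMf, hG⟩, hall⟩ := alg_baseM_classifyingPoint ℂ 3 d {m : DegIndex 3 d | Even (m.1 0 + m.1 1)} t₀ W hW hW'
    exact ⟨G, ⟨f, hf, coeff_odd_eq_zero_of_isSupportedOn hf hMf, hG⟩,
      fun f hf hev _ hG => (hall f hf (isSupportedOn_of_coeff_odd_eq_zero hev) hG).2⟩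
  · intro f hf hev hJ hXF ha
    have hMf := isSupportedOn_of_coeff_odd_eq_zero (d := d) hev
    have hY : IsSmoothProjective 3 (fiberOver (familyM ℂ 3 d {m : DegIndex 3 d | Even (m.1 0 + m.1 1)}) (classifyingPoint ℂ 3 d {m : DegIndex 3 d | Even (m.1 0 + m.1 1)} t₀ f)) := hu.isSmoothProjective _
    have hF := hFIBt hγ t₀ f hf hMf hJ
    have hF := hF hXF ha
    obtain ⟨hBn, hτ2, hτB, hΓτ, hΓB, φ, hφτ, ⟨c, hc, hφB⟩, hHG⟩ := hF
    -- no Γ-invariants: the NOINV piece at the base point (stepwise application through the `let`-telescope)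
    have hN := Summit.HodgeConjecture.HodgeConjecture.Theorems.SignSymmetricPowersNoInvariants.stub_signNoInvariants hGIC hd h4d
    have hGIC' := hN (classifyingPoint ℂ 3 d {m : DegIndex 3 d | Even (m.1 0 + m.1 1)} t₀ f)
    obtain ⟨⟨f₁, hf₁, hev₁, hn₁⟩, ⟨f₂, hf₂, hev₂, hn₂⟩, ⟨f₃, hf₃, hev₃, hn₃⟩⟩ := hNodal hd h4d
    have hM₁ := isSupportedOn_of_coeff_odd_eq_zero (d := d) hev₁
    have hM₂ := isSupportedOn_of_coeff_odd_eq_zero (d := d) hev₂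
    have hM₃ := isSupportedOn_of_coeff_odd_eq_zero (d := d) hev₃
    -- (piece applications are made stepwise: one-shot elaboration of the long `let`-telescopes times out)
    have hG := Summit.HodgeConjecture.HodgeConjecture.Theorems.SignSymmetricPowersMeridianGeneration.stub_signMeridianGeneration hZvK hPL hD0 hD1 hd h4d
    have hG := hG hγ t₀ f hf hMf hJ
    have hG := hG f₁ f₂ f₃
    have hG := hG hf₁ hM₁ hn₁
    have hG := hG hf₂ hM₂ hn₂
    have hG := hG hf₃ hM₃ hn₃
    obtain ⟨g₁, g₂, g₃, hg₁, hMg₁, hgp₁, hg₂, hMg₂, hgp₂, hg₃, hMg₃, hgp₃, ε₁, hε₁, hGENε⟩ := hG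
    have hP := Summit.HodgeConjecture.HodgeConjecture.Theorems.SignSymmetricPowersPencilTransvections.stub_signPencilTransvections hPL hd h4d
    have hP := hP hγ t₀ f hf hMf hJ
    obtain ⟨hPP, hPN, hP2⟩ := hP
    have hPP := hPP f₁ g₁ hf₁ hg₁
    have hPP := hPP hM₁ hMg₁ hn₁ hgp₁
    obtain ⟨εP, hεP, hPPε⟩ := hPP
    have hPN := hPN f₂ g₂ hf₂ hg₂
    have hPN := hPN hM₂ hMg₂ hn₂ hgp₂
    obtain ⟨εL, hεL, hPLε⟩ := hPN
    have hP2 := hP2 f₃ g₃ hf₃ hg₃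
    have hP2 := hP2 hM₃ hMg₃ hn₃ hgp₃
    obtain ⟨εD, hεD, hP2ε⟩ := hP2
    have hK := (Summit.HodgeConjecture.HodgeConjecture.Theorems.SignSymmetricPowersConfluenceLinkG.stub_signConfluenceLinkG hD0 hB2 hMC hD1 hPL) hd h4d
    have hK := hK hγ t₀ f hf hMf hJ
    have hK := hK hτ2 hτB hΓτ hΓB
    have hK₁ := hK ![0, 0, 0, 0, 1] (Or.inl rfl) f₁ g₁ hf₁ hg₁
    have hK₁ := hK₁ hM₁ hMg₁ hn₁ hgp₁ f₃ g₃ hf₃ hg₃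
    have hK₁ := hK₁ hM₃ hMg₃ hn₃ hgp₃
    obtain ⟨εK, hεK, hKε⟩ := hK₁
    have hK₂ := hK ![1, 0, 0, 0, 0] (Or.inr rfl) f₂ g₂ hf₂ hg₂
    have hK₂ := hK₂ hM₂ hMg₂ hn₂ hgp₂ f₃ g₃ hf₃ hg₃
    have hK₂ := hK₂ hM₃ hMg₃ hn₃ hgp₃
    obtain ⟨εK', hεK', hK'ε⟩ := hK₂
    -- a common radius below the six bounds
    have hm : 0 < min (min (min ε₁ εP) (min εL εD)) (min εK εK') :=
      lt_min (lt_min (lt_min hε₁ hεP) (lt_min hεL hεD)) (lt_min hεK hεK')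
    have hε : 0 < min (min (min ε₁ εP) (min εL εD)) (min εK εK') / 2 := half_pos hm
    have hεm : min (min (min ε₁ εP) (min εL εD)) (min εK εK') / 2 < min (min (min ε₁ εP) (min εL εD)) (min εK εK') :=
      half_lt_self hm
    have h₁ := hεm.trans_le ((min_le_left _ _).trans ((min_le_left _ _).trans (min_le_left _ _)))
    have h₂ := hεm.trans_le ((min_le_left _ _).trans ((min_le_left _ _).trans (min_le_right _ _)))
    have h₃ := hεm.trans_le ((min_le_left _ _).trans ((min_le_right _ _).trans (min_le_left _ _)))
    have h₄ := hεm.trans_le ((min_le_left _ _).trans ((min_le_right _ _).trans (min_le_right _ _)))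
    have h₅ := hεm.trans_le ((min_le_right _ _).trans (min_le_left _ _))
    have h₆ := hεm.trans_le ((min_le_right _ _).trans (min_le_right _ _))
    have hGENε := hGENε _ hε h₁
    obtain ⟨s₁, s₂, s₃, β₁, β₂, β₃, ω₁, ω₂, ω₃, T₁, T₂, T₃, E, hs₁, hω₁, hs₂, hω₂, hs₃, hω₃, hT₁, hT₂, hT₃, hΓE, hE⟩ := hGENε
    have hPPε := hPPε _ hε h₂ s₁ β₁ ω₁
    have hPPε := hPPε hs₁ hω₁ T₁ hT₁
    obtain ⟨rP, c₁, hrP0, hc₁, hτrP, hT₁eq⟩ := hPPε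
    have hPLε := hPLε _ hε h₃ s₂ β₂ ω₂
    have hPLε := hPLε hs₂ hω₂ T₂ hT₂
    obtain ⟨rL, c₂, hrL0, hc₂, hτrL, hT₂eq⟩ := hPLε
    have hP2ε := hP2ε _ hε h₄ s₃ β₃ ω₃
    have hP2ε := hP2ε hs₃ hω₃ T₃ hT₃
    obtain ⟨δ₀, c₃, hδ0, hδ0', hc₃, hBδτ, hT₃eq⟩ := hP2ε
    have hKε := hKε _ _ hε h₅ hε h₅ s₁ β₁ ω₁
    have hKε := hKε hs₁ hω₁ s₃ β₃ ω₃
    have hKε := hKε hs₃ hω₃ T₁ hT₁ T₃ hT₃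
    have hKε := hKε rP δ₀ c₁ c₃ hrP0 hδ0 hδ0' (Or.inl hτrP) hBδτ
    have hKε := hKε hT₁eq hT₃eq
    obtain ⟨gP, hgP, hlinkP⟩ := hKε
    have hK'ε := hK'ε _ _ hε h₆ hε h₆ s₂ β₂ ω₂
    have hK'ε := hK'ε hs₂ hω₂ s₃ β₃ ω₃
    have hK'ε := hK'ε hs₃ hω₃ T₂ hT₂ T₃ hT₃
    have hK'ε := hK'ε rL δ₀ c₂ c₃ hrL0 hδ0 hδ0' (Or.inr hτrL) hBδτ
    have hK'ε := hK'ε hT₂eq hT₃eq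
    obtain ⟨gL, hgL, hlinkL⟩ := hK'ε
    subst hT₁eq hT₂eq hT₃eq
    -- v12d seam (FIB-coreC: `B = c · φ^*B_{X_f}`, `c ≠ 0` opaque): GEO's form is `c⁻¹ • B`, the transvection parameters become `cᵢ * c`
    have e₁ := oneParamTransvectionEquiv_inv_smul _ hrP0 hc c₁
    have e₂ := oneParamTransvectionEquiv_inv_smul _ hrL0 hc c₂
    have e₃ := oneParamTransvectionEquiv_inv_smul _ hδ0 hc c₃
    have e₃' := oneParamTransvectionEquiv_inv_smul _ hδ0' hc c₃
    simp only [← e₁, ← e₂, ← e₃, ← e₃'] at hT₁ hT₂ hT₃ hE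
    refine ⟨φ, _, isAlt_smul_form (isAlt_tr_cup_of_odd hY ⟨1, by norm_num⟩) c⁻¹, nondegenerate_smul_form hBn (inv_ne_zero hc), _, hτ2,
      rP, rL, δ₀, c₁ * c, c₂ * c, c₃ * c, E, ?_⟩
    intro Γ
    -- `H³ ≠ 0`: LINK gives `B rP (gP δ₀) ≠ 0`, so `rP ≠ 0`
    have hNon : Nontrivial (bettiCohomology (fiberOver (familyM ℂ 3 d {m : DegIndex 3 d | Even (m.1 0 + m.1 1)}) (classifyingPoint ℂ 3 d {m : DegIndex 3 d | Even (m.1 0 + m.1 1)} t₀ f)) 3) :=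
      nontrivial_of_ne rP 0 fun h0 => hlinkP (by simp only [h0, map_zero, LinearMap.zero_apply])
    exact ⟨hNon, smul_form_invariant hτB c⁻¹, hφτ, inv_smul_form_eq hc hφB, hHG, hΓτ, smul_form_invariant_subgroup hΓB c⁻¹, hτrP, hτrL,
      smul_form_apply_eq_zero hBδτ c⁻¹, mul_ne_zero hc₁ hc, mul_ne_zero hc₂ hc, mul_ne_zero hc₃ hc, ⟨_, hT₁⟩, ⟨_, hT₂⟩, ⟨_, hT₃⟩, hΓE, hE,
      hGIC', ⟨gP, hgP, inv_smul_form_apply_ne_zero hlinkP hc⟩, ⟨gL, hgL, inv_smul_form_apply_ne_zero hlinkL hc⟩⟩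


open Literature.AlgebraicGeometry.Motives Literature.AlgebraicGeometry.Motives.UniversalHypersurface Literature.AlgebraicGeometry.HodgeTheory Literature.AlgebraicGeometry.HodgeTheory.UniversalHypersurface Literature.AlgebraicGeometry.HodgeTheory.BettiUniverse CategoryTheory.Limits in
/-- **The REGISTERED text of the derived GEO binder `stub_signPencilOrbitData` (`SignPencilOrbitDataF` of skeleton v12f)
modulo the two named facts F-B2PL and F-MC** (port of the seam `signPencilOrbitDataF_of_pieces`). -/
theorem signPencilOrbitDataF_of_facts (hB2 : Literature.AlgebraicGeometry.HodgeTheory.picardLefschetz_symmetricA3)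
    (hMC : Literature.AlgebraicGeometry.FundamentalGroup.affineHypersurfaceComplement_meridian_isConj) :
    open Literature.AlgebraicGeometry.Motives Literature.AlgebraicGeometry.HodgeTheory Literature.AlgebraicGeometry.HodgeTheory.BettiUniverse CategoryTheory.Limits in Literature.AlgebraicGeometry.FundamentalGroup.affineHypersurfaceComplement_meridians_normalClosure_eq_top → picardLefschetz_nodalForms_uniform → deligne_globalInvariantCycles → (∀ (n d : ℕ), 2 ≤ d → ∃ Disc : MvPolynomial (Literature.AlgebraicGeometry.Motives.UniversalHypersurface.DegIndex n d) ℂ, Irreducible Disc ∧ Disc.IsHomogeneous Disc.totalDegree ∧ 0 < Disc.totalDegree ∧ ∀ a : Literature.AlgebraicGeometry.Motives.UniversalHypersurface.DegIndex n d → ℂ, a ∈ Literature.AlgebraicGeometry.HodgeTheory.singularCoeffs n d ↔ MvPolynomial.eval a Disc = 0) → discriminant_localBranches_nodal → (∀ ⦃d : ℕ⦄, Even d → 4 ≤ d → (∃ f : MvPolynomial (Fin 5) ℂ, f.IsHomogeneous d ∧ (∀ e : Fin 5 →₀ ℕ, ¬ Even (e 0 + e 1) → f.coeff e = 0) ∧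 IsNodalFormWithNodes f ![![0, 0, 0, 0, 1]]) ∧ (∃ f : MvPolynomial (Fin 5) ℂ, f.IsHomogeneous d ∧ (∀ e : Fin 5 →₀ ℕ, ¬ Even (e 0 + e 1) → f.coeff e = 0) ∧ IsNodalFormWithNodes f ![![1, 0, 0, 0, 0]]) ∧ (∃ f : MvPolynomial (Fin 5) ℂ, f.IsHomogeneous d ∧ (∀ e : Fin 5 →₀ ℕ, ¬ Even (e 0 + e 1) → f.coeff e = 0) ∧ IsNodalFormWithNodes f ![![1, 0, 1, 0, 0], ![-1, 0, 1, 0, 0]])) → ∀ ⦃d : ℕ⦄, Even d → 4 ≤ d → ∃ (𝒳 S : SchemeOver ℂ) (u : 𝒳 ⟶ S) (hu : IsSmoothProjectiveFamily u 3) (_ : IsQuasiProjectiveOver S) (_ : AlgebraicGeometry.Smooth S.hom) (_ : IrreducibleSpace S.left) (hU : IsCohomologicallyLocallyTrivialOn u Set.univ) (A : ∀ t, HodgeModel 3 (fiberOver u t)) (hA : ∀ t, (A t).IsHodgeSymmetric) (hfin : ∀ t, Module.Finite ℚ (bettiCohomology (fiberOver u t) 3)) (pt : MvPolynomial (Fin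 5) ℂ → ComplexPoints S), (∀ W, IsZariskiClosedOnPoints S W → W ≠ Set.univ → ∃ G : MvPolynomial {e : Fin 5 →₀ ℕ // e.degree = d} ℂ, (∃ f : MvPolynomial (Fin 5) ℂ, f.IsHomogeneous d ∧ (∀ e : Fin 5 →₀ ℕ, ¬ Even (e 0 + e 1) → f.coeff e = 0) ∧ MvPolynomial.eval (fun e => f.coeff e.1) G ≠ 0) ∧ ∀ f : MvPolynomial (Fin 5) ℂ, f.IsHomogeneous d → (∀ e : Fin 5 →₀ ℕ, ¬ Even (e 0 + e 1) → f.coeff e = 0) → IsSmoothProjective 3 (SmoothHypersurface.hypersurface f) → MvPolynomial.eval (fun e => f.coeff e.1) G ≠ 0 → pt f ∉ W) ∧ (∀ f : MvPolynomial (Fin 5) ℂ, f.IsHomogeneous d → (∀ e : Fin 5 →₀ ℕ, ¬ Even (e 0 + e 1) → f.coeff e = 0) → SmoothHypersurface.IsNonsingularForm ℂ f → ∀ (hXF : IsSmoothProjective 3 (SmoothHypersurface.hypersurface f)) (ha : (fun i : Fin 5 => if (i : ℕ) < 2 then (-1 : ℂˣ) else 1) ∈ diagonalStabilizer f), let Y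 := fiberOver u (pt f); ∃ (φ : bettiCohomology Y 3 ≃ₗ[ℚ] bettiCohomology (SmoothHypersurface.hypersurface f) 3) (B : LinearMap.BilinForm ℚ (bettiCohomology Y 3)) (hB : B.IsAlt) (_ : B.Nondegenerate) (τ : bettiCohomology Y 3 →ₗ[ℚ] bettiCohomology Y 3) (_ : τ ^ 2 = 1) (rP rL δ₀ : bettiCohomology Y 3) (c₁ c₂ c₃ : ℚ) (E : Set (bettiCohomology Y 3 ≃ₗ[ℚ] bettiCohomology Y 3)), let Γ := (haveI := hfin (pt f); ratMonodromyGroup u 3 hU ⟨pt f, Set.mem_univ _⟩); Nontrivial (bettiCohomology Y 3) ∧ (∀ x y, B (τ x) (τ y) = B x y) ∧ (∀ x, φ (τ x) = pull (diagonalAut f ha) 3 (φ x)) ∧ (∀ x y, B x y = tr hXF (3 + 3) (cup (SmoothHypersurface.hypersurface f) 3 3 (φ x) (φ y))) ∧ (haveI : HodgeTensorFacts.{0, 0} := hodgeTensorFacts_holds; haveI := finite hXF 3; haveI := hfin (pt f); ∀ k, k ∈ ((A (pt f)).hodgeStructure (hu.isSmoothProjective (pt f)) (hA (pt f)) 3).hodgeGroup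 → (φ.symm.trans k).trans φ ∈ (hodge exists_isReal_hodgeModel_holds hXF 3).hodgeGroup) ∧ (∀ g ∈ Γ, ∀ x, g (τ x) = τ (g x)) ∧ (∀ g ∈ Γ, ∀ x y, B (g x) (g y) = B x y) ∧ τ rP = rP ∧ τ rL = -rL ∧ B δ₀ (τ δ₀) = 0 ∧ c₁ ≠ 0 ∧ c₂ ≠ 0 ∧ c₃ ≠ 0 ∧ oneParamTransvectionEquiv B (hB rP) c₁ ∈ Γ ∧ oneParamTransvectionEquiv B (hB rL) c₂ ∈ Γ ∧ oneParamTransvectionEquiv B (hB δ₀) c₃ * oneParamTransvectionEquiv B (hB (τ δ₀)) c₃ ∈ Γ ∧ Γ = Subgroup.closure E ∧ (∀ e ∈ E, ∃ g ∈ Γ, e = g * oneParamTransvectionEquiv B (hB rP) c₁ * g⁻¹ ∨ e = g * oneParamTransvectionEquiv B (hB rL) c₂ * g⁻¹ ∨ e = g * (oneParamTransvectionEquiv B (hB δ₀) c₃ * oneParamTransvectionEquiv B (hB (τ δ₀)) c₃) * g⁻¹) ∧ (∀ x, (∀ g ∈ Γ, g x = x) → x = 0) ∧ (∃ g ∈ Γ,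 B rP (g δ₀) ≠ 0) ∧ (∃ g ∈ Γ, B rL (g δ₀) ≠ 0)) :=
  fun hZvK hPL hGIC hD0 hD1 hNodal => signPencilOrbitData_of_facts hB2 hMC hZvK hPL hGIC hD0 hD1 hNodal

end Summit.HodgeConjecture.HodgeConjecture.Theorems.SignSymmetricPowersPencilOrbitData
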